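import Summits.AtomisticToContinuum.Crystallization.Theorems.ChargedEnergyGap.Negative.NoBoundaryReduction
import Literature.MathematicalPhysics.StatisticalMechanics.LennardJonesThermodynamicLimitProofs

/-!
# `ChargedEnergyGap` (stmt-AtomisticToContinuum-14231), negative side IV: the tolerance is load-bearing

With `η ≤ 0` in place of `1/100` the priced gap is false for every `κ > 0`, `C`, given the route's
support item `CrysEnergyUpper` (generic perturbation `yᵢ + t·4ⁱ·e₀`).  All `[folklore]`.
-/

noncomputable section

namespace Summit.AtomisticToContinuum.Crystallization.Theorems.ChargedEnergyGapNegative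

open Literature.MathematicalPhysics.StatisticalMechanics
open Literature.Geometry.DiscreteGeometry
open Summit.AtomisticToContinuum.Crystallization.Theses.PricedLinkCensus
open scoped BigOperators

/-! ## §6. The tolerance is load-bearing: with `η ≤ 0` the priced gap is FALSE

(granted that finite configurations approach the periodic infimum from above — hypothesis
`hTS` below, a consequence of the route's own support item `CrysEnergyUpper` (stmt 11865) proved
here, and proved OUTRIGHT in the companion module `…Negative.BlocksBound` (`exists_trialState`).)
With `η < 0` no bond exists at all (a bond at `j` would be shorter than `nn_j`), so EVERY site
of EVERY configuration is charged and the gap would say `N(e* + κ) ≤ E(y)` for all `y`;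
with `η = 0` the same holds for every configuration whose distances from each site are pairwise
distinct — a generic (dense) condition reached from any `y` by an arbitrarily small explicit
perturbation — so near-optimal trial states, slightly perturbed, are fully charged at cost `→ 0`.
-/

section Tolerance

/-! `TrialStates` (used as an explicit hypothesis below, and PROVED in the companion module
`…Negative.BlocksBound`, `exists_trialState`): finite injective configurations approach `e*` from
above, `∀ δ > 0, ∃ N ≥ 1, ∃ y injective, E_LJ(y) < N(e* + δ)`. -/

/-- `E(N) ≤ 0` for Lennard-Jones ground-state energies (subadditivity with `E(0) = E(1) = 0`). [folklore] -/
theorem groundStateEnergy_nonpos (N : ℕ) : groundStateEnergy lennardJones 3 N ≤ 0 := by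
  have hsub := subadditive_groundStateEnergy_lennardJones (by norm_num : 0 < 3)
  have h := hsub.apply_mul_add_le N 1 0
  simp only [mul_one, add_zero] at h
  have h1 : groundStateEnergy lennardJones 3 1 = 0 := groundStateEnergy_of_le_one _ le_rfl
  have h0 : groundStateEnergy lennardJones 3 0 = 0 := groundStateEnergy_of_le_one _ (by norm_num)
  rw [h1, h0] at h
  simpa using h

/-- **`CrysEnergyUpper → TrialStates`**: from `limsup E(N)/N ≤ e*` (the sequence is bounded above
by `0`) some `E(N)/N < e* + δ`, and `E(N)` is an infimum over injective configurations. [folklore] -/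
theorem trialStates_of_crysEnergyUpper (h : CrysEnergyUpper) :
    ∀ δ : ℝ, 0 < δ → ∃ (N : ℕ) (y : Fin N → E3), 0 < N ∧ Function.Injective y ∧
      interactionEnergy lennardJones y < (N : ℝ) * (eStar + δ) := by
  intro δ hδ
  have hlt : Filter.limsup (fun N : ℕ => groundStateEnergy lennardJones 3 N / N) Filter.atTop <
      eStar + δ := lt_of_le_of_lt h (by unfold eStar; linarith)
  have hbdd : Filter.IsBoundedUnder (· ≤ ·) Filter.atTop
      (fun N : ℕ => groundStateEnergy lennardJones 3 N / N) := by
    refine Filter.isBoundedUnder_of ⟨0, fun N => ?_⟩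
    rcases Nat.eq_zero_or_pos N with rfl | hN
    · simp
    · exact div_nonpos_iff.2 (Or.inr ⟨groundStateEnergy_nonpos N, Nat.cast_nonneg N⟩)
  have hev := Filter.eventually_lt_of_limsup_lt hlt hbdd
  obtain ⟨N, hNlt, hN1⟩ := (hev.and (Filter.eventually_ge_atTop 1)).exists
  have hN : (0 : ℝ) < N := by exact_mod_cast hN1
  rw [div_lt_iff₀ hN] at hNlt
  haveI := nonempty_injective_config (by norm_num : 0 < 3) N
  obtain ⟨⟨y, hy⟩, hylt⟩ := exists_lt_of_ciInf_lt
    (f := fun x : {x : Fin N → E3 // Function.Injective x} => interactionEnergy lennardJones x.1)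
    hNlt
  exact ⟨N, y, hN1, hy, by simpa [mul_comm] using hylt⟩

/-- With a NEGATIVE tolerance there are no bonds at all (a bond `{j, k}` would have length
`≤ (1 + η)·min(nn_j, nn_k) < min(nn_j, nn_k) ≤ dist`), for injective configurations. [folklore] -/
theorem not_adj_of_eta_neg {η : ℝ} (hη : η < 0) {N : ℕ} {y : Fin N → E3}
    (hy : Function.Injective y) (j k : Fin N) : ¬ (bondGraph η y).Adj j k := by
  intro h
  obtain ⟨hne, hle⟩ := bondGraph_adj.1 h
  have hpos : 0 < dist (y j) (y k) := dist_pos.2 (hy.ne hne)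
  have hm : min (nearestDist y j) (nearestDist y k) ≤ dist (y j) (y k) :=
    (min_le_left _ _).trans (nearestDist_le_dist y hne.symm)
  have hm0 : 0 ≤ min (nearestDist y j) (nearestDist y k) :=
    le_min (nearestDist_nonneg _ _) (nearestDist_nonneg _ _)
  rcases hm0.eq_or_lt with hm0' | hmpos
  · rw [← hm0', mul_zero] at hle
    linarith
  · have : (1 + η) * min (nearestDist y j) (nearestDist y k) <
        min (nearestDist y j) (nearestDist y k) := by nlinarith
    linarith

/-- Hence with `η < 0` every site of an injective configuration is charged. [folklore] -/
theorem charged_eq_of_eta_neg {η : ℝ} (hη : η < 0) {N : ℕ} {y : Fin N → E3}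
    (hy : Function.Injective y) : charged η y = N := by
  unfold charged
  have h : ∀ i : Fin N, ¬ IsChargeFree η y i := fun i hcf => by
    have hempty : (bondGraph η y).neighborSet i = ∅ := by
      ext k
      simp only [SimpleGraph.mem_neighborSet, Set.mem_empty_iff_false, iff_false]
      exact not_adj_of_eta_neg hη hy i k
    have := hcf.1
    rw [hempty, Set.ncard_empty] at this
    exact absurd this (by norm_num)
  rw [Nat.card_congr (Equiv.subtypeUnivEquiv h), Nat.card_eq_fintype_card, Fintype.card_fin]

/-- **`η < 0` kills the gap** (given `TrialStates`): `N(e* + κ) ≤ E(y)` for all `y` is absurd. [folklore] -/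
theorem not_gapWith_of_eta_neg
    (hTS : ∀ δ : ℝ, 0 < δ → ∃ (N : ℕ) (y : Fin N → E3), 0 < N ∧ Function.Injective y ∧
      interactionEnergy lennardJones y < (N : ℝ) * (eStar + δ))
    {η κ : ℝ} (hη : η < 0) (hκ : 0 < κ) (C : ℝ) : ¬ GapWith η κ C := by
  intro h
  have hnb := noBoundary_of_gapWith (by linarith) h
  obtain ⟨N, y, -, hy, hlt⟩ := hTS κ hκ
  have := hnb N y hy
  rw [charged_eq_of_eta_neg hη hy] at this
  linarith

/-! ### `η = 0`: generic configurations are fully charged -/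

/-- Zeros of a genuine quadratic form a finite set. [folklore] -/
theorem finite_quadratic_zeros {A B C : ℝ} (hC : C ≠ 0) :
    {t : ℝ | A + B * t + C * t ^ 2 = 0}.Finite := by
  set p : Polynomial ℝ := Polynomial.C C * Polynomial.X ^ 2 + Polynomial.C B * Polynomial.X +
    Polynomial.C A with hp_def
  have hp : p ≠ 0 := by
    intro h0
    have h2 : p.coeff 2 = C := by
      simp [hp_def, Polynomial.coeff_X_pow]
    rw [h0, Polynomial.coeff_zero] at h2
    exact hC h2.symm
  refine (p.roots.toFinset.finite_toSet).subset fun t ht => ?_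
  simp only [Set.mem_setOf_eq] at ht
  rw [Finset.mem_coe, Multiset.mem_toFinset, Polynomial.mem_roots hp, Polynomial.IsRoot.def]
  simp only [hp_def, Polynomial.eval_add, Polynomial.eval_mul, Polynomial.eval_C,
    Polynomial.eval_pow, Polynomial.eval_X]
  linarith

/-- In `ℕ`: `4ʲ + 4ᵏ ≠ 2·4ⁱ` whenever `j ≠ i` and `k ≠ i`. [folklore] -/
theorem four_pow_add_ne {i j k : ℕ} (hj : j ≠ i) (hk : k ≠ i) : 4 ^ j + 4 ^ k ≠ 2 * 4 ^ i := by
  intro h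
  have h4 : (0 : ℕ) < 4 ^ j := by positivity
  have h4' : (0 : ℕ) < 4 ^ k := by positivity
  rcases lt_or_gt_of_ne hj with hj | hj <;> rcases lt_or_gt_of_ne hk with hk | hk
  · have h1 : 4 ^ j ≤ 4 ^ (i - 1) := Nat.pow_le_pow_right (by norm_num) (by omega)
    have h2 : 4 ^ k ≤ 4 ^ (i - 1) := Nat.pow_le_pow_right (by norm_num) (by omega)
    have h3 : 4 ^ i = 4 * 4 ^ (i - 1) := by
      rw [← pow_succ']; congr 1; omega
    omega
  · have h2 : 4 ^ (i + 1) ≤ 4 ^ k := Nat.pow_le_pow_right (by norm_num) (by omega)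
    rw [pow_succ] at h2; omega
  · have h2 : 4 ^ (i + 1) ≤ 4 ^ j := Nat.pow_le_pow_right (by norm_num) (by omega)
    rw [pow_succ] at h2; omega
  · have h2 : 4 ^ (i + 1) ≤ 4 ^ j := Nat.pow_le_pow_right (by norm_num) (by omega)
    rw [pow_succ] at h2; omega

variable {N : ℕ}

/-- Perturbation weights `wᵢ = 4ⁱ`. [folklore] -/
def wt (i : Fin N) : ℝ := (4 : ℝ) ^ (i : ℕ)

/-- `wᵢ` is the cast of the natural number `4ⁱ`. [folklore] -/
theorem wt_eq_cast (i : Fin N) : wt i = ((4 ^ (i : ℕ) : ℕ) : ℝ) := by simp [wt]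

/-- The weights are pairwise distinct. [folklore] -/
theorem wt_injective : Function.Injective (wt (N := N)) := by
  intro i j h
  rw [wt_eq_cast, wt_eq_cast] at h
  have h' : 4 ^ (i : ℕ) = 4 ^ (j : ℕ) := by exact_mod_cast h
  exact Fin.ext (Nat.pow_right_injective (by norm_num : 2 ≤ 4) h')

/-- The squared coefficients `(wᵢ − wⱼ)²`, `j ≠ i`, are pairwise distinct. [folklore] -/
theorem wt_sq_sub_ne {i j k : Fin N} (hj : j ≠ i) (hk : k ≠ i) (hjk : j ≠ k) :
    (wt i - wt j) ^ 2 - (wt i - wt k) ^ 2 ≠ 0 := by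
  intro h
  have h' : (wt j - wt k) * (wt j + wt k - 2 * wt i) = 0 := by linear_combination h
  rcases mul_eq_zero.1 h' with h1 | h1
  · exact hjk (wt_injective (sub_eq_zero.1 h1))
  · have h2 : 4 ^ (j : ℕ) + 4 ^ (k : ℕ) = 2 * 4 ^ (i : ℕ) := by
      rw [wt_eq_cast, wt_eq_cast, wt_eq_cast] at h1
      exact_mod_cast (by linarith : ((4 ^ (j : ℕ) : ℕ) : ℝ) + ((4 ^ (k : ℕ) : ℕ) : ℝ) =
        2 * ((4 ^ (i : ℕ) : ℕ) : ℝ))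
    exact four_pow_add_ne (Fin.val_ne_of_ne hj) (Fin.val_ne_of_ne hk) h2

variable (y : Fin N → E3)

/-- The explicit perturbation `yᵢ + t·4ⁱ·e₀`. [folklore] -/
def pert (t : ℝ) : Fin N → E3 := fun i => y i + (t * wt i) • e0

/-- At `t = 0` the perturbation is the identity. [folklore] -/
@[simp] theorem pert_zero : pert y 0 = y := by
  funext i; simp [pert]

/-- Differences of perturbed points. [folklore] -/
theorem pert_sub (t : ℝ) (i j : Fin N) :
    pert y t i - pert y t j = (y i - y j) + (t * (wt i - wt j)) • e0 := by
  simp only [pert, mul_sub, sub_smul]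
  abel

/-- Squared perturbed distances are explicit quadratics in `t`. [folklore] -/
theorem dist_pert_sq (t : ℝ) (i j : Fin N) :
    dist (pert y t i) (pert y t j) ^ 2 =
      ‖y i - y j‖ ^ 2 + 2 * (t * (wt i - wt j)) * inner ℝ (y i - y j) e0 +
        (t * (wt i - wt j)) ^ 2 := by
  rw [dist_eq_norm, pert_sub, norm_add_sq_real, real_inner_smul_right, norm_smul, norm_e0,
    mul_one, Real.norm_eq_abs, sq_abs]
  ring

/-- For a triple of distinct indices, the perturbed distances `|i j|`, `|i k|` agree only at
the zeros of a genuine quadratic in `t`: finitely many `t`. [folklore] -/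
theorem finite_bad_triple (i j k : Fin N) :
    {t : ℝ | j ≠ i ∧ k ≠ i ∧ j ≠ k ∧
      dist (pert y t i) (pert y t j) = dist (pert y t i) (pert y t k)}.Finite := by
  by_cases hc : j ≠ i ∧ k ≠ i ∧ j ≠ k
  · obtain ⟨hj, hk, hjk⟩ := hc
    refine (finite_quadratic_zeros (A := ‖y i - y j‖ ^ 2 - ‖y i - y k‖ ^ 2)
      (B := 2 * (wt i - wt j) * inner ℝ (y i - y j) e0 - 2 * (wt i - wt k) * inner ℝ (y i - y k) e0)
      (wt_sq_sub_ne hj hk hjk)).subset ?_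
    rintro t ⟨-, -, -, ht⟩
    have h2 : dist (pert y t i) (pert y t j) ^ 2 = dist (pert y t i) (pert y t k) ^ 2 := by
      rw [ht]
    rw [dist_pert_sq, dist_pert_sq] at h2
    simp only [Set.mem_setOf_eq]
    linear_combination h2
  · refine Set.finite_empty.subset ?_
    rintro t ⟨hj, hk, hjk, -⟩
    exact (hc ⟨hj, hk, hjk⟩).elim

/-- Two distinct sites collide for at most one value of `t`. [folklore] -/
theorem finite_bad_pair (i j : Fin N) : {t : ℝ | i ≠ j ∧ pert y t i = pert y t j}.Finite := by
  by_cases hij : i = j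
  · refine Set.finite_empty.subset ?_
    rintro t ⟨h, -⟩
    exact (h hij).elim
  · apply Set.Subsingleton.finite
    rintro t ⟨-, ht⟩ t' ⟨-, ht'⟩
    have e1 : (y i - y j) + (t * (wt i - wt j)) • e0 = 0 := by
      rw [← pert_sub, sub_eq_zero]; exact ht
    have e2 : (y i - y j) + (t' * (wt i - wt j)) • e0 = 0 := by
      rw [← pert_sub, sub_eq_zero]; exact ht'
    have h1 : ((t - t') * (wt i - wt j)) • e0 = 0 := by
      have : (t * (wt i - wt j)) • e0 - (t' * (wt i - wt j)) • e0 = 0 := by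
        have h := congrArg₂ (· - ·) e1 e2
        simpa using h
      rw [← sub_smul] at this
      convert this using 2
      ring
    rcases smul_eq_zero.1 h1 with h2 | h2
    · rcases mul_eq_zero.1 h2 with h3 | h3
      · linarith
      · exact absurd (wt_injective (sub_eq_zero.1 h3)) hij
    · exact absurd h2 e0_ne_zero

/-- The energy of the perturbed configuration depends continuously on `t` at `t = 0`
(all distances are non-zero there, where `V_LJ` is continuous). [folklore] -/
theorem tendsto_energy_pert (hy : Function.Injective y) :
    Filter.Tendsto (fun t => interactionEnergy lennardJones (pert y t)) (nhds 0)
      (nhds (interactionEnergy lennardJones y)) := by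
  have h0 : interactionEnergy lennardJones y = interactionEnergy lennardJones (pert y 0) := by
    rw [pert_zero]
  rw [h0]
  unfold interactionEnergy
  refine tendsto_finsetSum _ fun i _ => tendsto_finsetSum _ fun j hj => ?_
  have hne : y i ≠ y j := hy.ne (Finset.mem_Ioi.1 hj).ne
  have hcont : Continuous fun t : ℝ => dist (pert y t i) (pert y t j) := by
    simp only [pert]
    fun_prop
  have hd0 : dist (pert y 0 i) (pert y 0 j) ∈ ({0}ᶜ : Set ℝ) := by
    rw [pert_zero]; exact dist_ne_zero.2 hne
  exact ((continuousOn_lennardJones.continuousAt (isOpen_compl_singleton.mem_nhds hd0)).tendsto).comp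
    (hcont.tendsto 0)

/-- **Generic perturbation.** Every injective configuration admits, at arbitrarily small energy
cost, an injective perturbation in which the distances from each site to the others are
pairwise distinct. [folklore] -/
theorem exists_pert (hy : Function.Injective y) {ε : ℝ} (hε : 0 < ε) :
    ∃ t : ℝ, Function.Injective (pert y t) ∧
      (∀ i j k : Fin N, j ≠ i → k ≠ i → j ≠ k →
        dist (pert y t i) (pert y t j) ≠ dist (pert y t i) (pert y t k)) ∧
      interactionEnergy lennardJones (pert y t) < interactionEnergy lennardJones y + ε := by
  have hev : ∀ᶠ t in nhds (0 : ℝ),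
      interactionEnergy lennardJones (pert y t) < interactionEnergy lennardJones y + ε :=
    (tendsto_energy_pert y hy).eventually (gt_mem_nhds (lt_add_of_pos_right _ hε))
  obtain ⟨r, hr, hball⟩ := Metric.eventually_nhds_iff.1 hev
  set B : Set ℝ :=
    (⋃ i : Fin N, ⋃ j : Fin N, ⋃ k : Fin N, {t : ℝ | j ≠ i ∧ k ≠ i ∧ j ≠ k ∧
      dist (pert y t i) (pert y t j) = dist (pert y t i) (pert y t k)}) ∪
    ⋃ i : Fin N, ⋃ j : Fin N, {t : ℝ | i ≠ j ∧ pert y t i = pert y t j} with hB_def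
  have hB : B.Finite :=
    (Set.finite_iUnion fun i => Set.finite_iUnion fun j => Set.finite_iUnion fun k =>
      finite_bad_triple y i j k).union
      (Set.finite_iUnion fun i => Set.finite_iUnion fun j => finite_bad_pair y i j)
  obtain ⟨t, ht, htB⟩ := ((Set.Ioo_infinite hr).sdiff hB).nonempty
  refine ⟨t, ?_, ?_, hball ?_⟩
  · intro i j hij
    by_contra hne
    exact htB (Or.inr (Set.mem_iUnion.2 ⟨i, Set.mem_iUnion.2 ⟨j, hne, hij⟩⟩))
  · intro i j k hj hk hjk heq
    exact htB (Or.inl (Set.mem_iUnion.2 ⟨i, Set.mem_iUnion.2 ⟨j, Set.mem_iUnion.2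
      ⟨k, hj, hk, hjk, heq⟩⟩⟩))
  · rw [Real.dist_eq, sub_zero, abs_of_pos ht.1]
    exact ht.2

variable {y}

/-- At tolerance `η = 0` a configuration with pairwise distinct distances from each site is
FULLY charged: a bond at `i` has length exactly `nn_i`, so there is at most one. [folklore] -/
theorem charged_eq_of_distinct
    (h : ∀ i j k : Fin N, j ≠ i → k ≠ i → j ≠ k → dist (y i) (y j) ≠ dist (y i) (y k)) :
    charged 0 y = N := by
  unfold charged
  have hall : ∀ i : Fin N, ¬ IsChargeFree 0 y i := fun i hcf => by
    have h12 := hcf.1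
    obtain ⟨j, k, hj, hk, hjk⟩ := (Set.one_lt_ncard_iff hcf.finite_neighborSet).1
      (by rw [h12]; norm_num)
    rw [mem_neighborSet_bondGraph] at hj hk
    have e1 : dist (y i) (y j) = nearestDist y i :=
      le_antisymm (hj.2.trans (by rw [add_zero, one_mul]; exact min_le_left _ _))
        (nearestDist_le_dist y hj.1.symm)
    have e2 : dist (y i) (y k) = nearestDist y i :=
      le_antisymm (hk.2.trans (by rw [add_zero, one_mul]; exact min_le_left _ _))
        (nearestDist_le_dist y hk.1.symm)
    exact h i j k hj.1.symm hk.1.symm hjk (e1.trans e2.symm)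
  rw [Nat.card_congr (Equiv.subtypeUnivEquiv hall), Nat.card_eq_fintype_card, Fintype.card_fin]

/-- **`η = 0` kills the gap** (given `TrialStates`): perturb a near-optimal trial state
generically; it becomes fully charged at energy cost `→ 0`. So any proof must use `η > 0`
quantitatively (the crux fixes `η = 1/100`). [folklore] -/
theorem not_gapWith_eta_zero
    (hTS : ∀ δ : ℝ, 0 < δ → ∃ (N : ℕ) (y : Fin N → E3), 0 < N ∧ Function.Injective y ∧
      interactionEnergy lennardJones y < (N : ℝ) * (eStar + δ))
    {κ : ℝ} (hκ : 0 < κ) (C : ℝ) : ¬ GapWith 0 κ C := by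
  intro h
  have hnb := noBoundary_of_gapWith (by norm_num) h
  obtain ⟨N, y, hN, hy, hlt⟩ := hTS (κ / 2) (half_pos hκ)
  have hNr : (0 : ℝ) < N := by exact_mod_cast hN
  obtain ⟨t, hinj, hdist, hE⟩ := exists_pert y hy (ε := (N : ℝ) * (κ / 2)) (by positivity)
  have := hnb N (pert y t) hinj
  rw [charged_eq_of_distinct hdist] at this
  linarith

/-- The same for the crux's literal shape at `η = 0` and at `η < 0`, from the route's own
support item `CrysEnergyUpper`. [folklore] -/
theorem not_gapWith_of_eta_nonpos (hUB : CrysEnergyUpper) {η κ : ℝ} (hη : η ≤ 0) (hκ : 0 < κ)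
    (C : ℝ) : ¬ GapWith η κ C := by
  rcases hη.lt_or_eq with hη | rfl
  · exact not_gapWith_of_eta_neg (trialStates_of_crysEnergyUpper hUB) hη hκ C
  · exact not_gapWith_eta_zero (trialStates_of_crysEnergyUpper hUB) hκ C

end Tolerance

end Summit.AtomisticToContinuum.Crystallization.Theorems.ChargedEnergyGapNegative

end
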